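import Literature.Computability.Complexity.PromiseMA
import Literature.Computability.Complexity.ClockedUniversalAcceptanceProofs
import Literature.Computability.Complexity.ExpPadding
import Literature.Computability.Complexity.TruncMapMachine
import Literature.Computability.Complexity.MapFstMachine
import Literature.Computability.Complexity.PlumbingBricks
import Literature.Computability.Complexity.UnaryBricks
import Literature.Computability.Complexity.FPStringBricks
import Literature.Computability.Complexity.StringCopy
import Literature.Computability.Complexity.StringEquality
import Literature.Computability.Complexity.CountingHierarchyProofs
import Literature.Computability.Complexity.NSubexp
import Literature.Computability.Complexity.CodeFPArith
import HarnessLib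

/-!
# Infinitely-often Merlin–Arthur protocols at time scale `2^{O(n/q)}` are simulated in `NTIME(2ⁿ)`
# when `pr-MA ⊆ pr-NP` (the class-level step of Buhrman–Fortnow–Pavan, Lemma 3.7)

Literature / complexity — derandomization. Buhrman–Fortnow–Pavan (*Some results on
derandomization*, Theory Comput. Syst. 38 (2005)) prove their Thm. 3.1 (`DistNP ⊆ AvgP ⟹ P = BPP`)
through two lemmas (p. 5):

> **Lemma 3.4.** Suppose that for all `ε` and `A` in `E` and for infinitely many lengths `n`, `Aₙ`
> has circuits of size `2^{εn}`. For every `ε > 0` and `A` in `E`, there exists a Merlin–Arthur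
> protocol where Arthur uses time `2^{εn}` and for infinitely many `n`, if `|x| = n` then: if `x` is
> in `A` then Arthur will accept with probability at least `2/3`; if `x` is not in `A`, no matter
> what is Merlin's message, Arthur will accept with probability at most `1/3`.
>
> **Lemma 3.7.** Assume `NP` is easy on average. If for all `ε > 0`, `E` infinitely often has
> circuits of size `2^{εn}` then for all `A` in `E` and `ε > 0` there is a language `L` in
> `NTIME(2^{εn})` such that for infinitely many `n`, `Aₙ = Lₙ`.

The printed proof of Lemma 3.7 combines Lemma 3.4 with "the techniques of Theorem 3.6"
(Köbler–Schuler: `NP` easy on average `⟹ MA = NP`). Hirahara (ECCC TR21-058, Lemma 3.4, proof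
sketch, items 2–3) records the same step through the CLASS statement `pr-MA = pr-NP` ([KS04]),
which the tree proves under the average-case hypothesis
(`MetaComplexity/AvgCaseMADerandomization.lean`). This file proves the remaining, purely
structural step: **from the conclusion of Lemma 3.4 (`IOMA A`, below) and `pr-MA ⊆ pr-NP`, some
`B ∈ NTIME(2ⁿ)` agrees with `A` on all inputs of infinitely many lengths**
(`exists_NTIME_two_pow_of_ioma`). The inclusion `pr-MA ⊆ pr-NP` alone loses the exponent of the
simulating `NP` machine, which must stay uniform in `ε`; it is recovered by a padding argument
through ONE promise problem (Arora–Barak 2009, §2.6.2 "translating upward"; the canonical complete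
problem of promise-`MA`, cf. Thm. 2.9 `TMSAT`):

* `IOMA A` — the conclusion of BFP's Lemma 3.4 for `A`, in the predicate form of `MA`
  (Impagliazzo–Kabanets–Wigderson 2002, §2.1; the tree's `PromiseMA'`): ONE exponent `k` and, for
  every scale `q ≥ 1`, a referee `R ∈ DTIME(N^k)` on triples `⟨⟨x, y⟩, z⟩` with messages and coins
  of length `maScale q n = 2^{⌊n/q⌋ + 1}` (so Arthur's time is `2^{O(k n/q)}`: "time `2^{εn}` for
  every `ε`"), correct with the `2/3`–`1/3` gap at all inputs of infinitely many lengths `n`;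
* `UMARef k'`, `UMA k'` — the **universal promise-`MA` problem with clock exponent `k'`**:
  instances `w = ⟨v, ⟨e, x⟩⟩`; the referee runs the clocked universal acceptance machine of the tree
  (`ClockedUA.U ∈ P`, `ClockedUniversalAcceptanceProofs.lean`) on the program `e`, the triple
  `⟨⟨x, y ↾ M⟩, z ↾ M⟩` (`M = 2^{⌊log₂(|v| - 1)⌋}`, the scale coded by the length of `v`) and the
  budget `1^{|w|^{k'}}`; `UMA k' ∈ PromiseMA'` by definition of its promise (`UMA_mem_PromiseMA'`);
* the padding `wOf q e x = ⟨1^{2^{m}} 0 (x ↾ m), ⟨e, x⟩⟩`, `m = ⌊n/q⌋ + 1` (the exponential pad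
  `expPad 1` of `ExpPadding.lean` on a prefix of `x`): at a good length, `x ∈ A` iff `wOf q e x` is a
  yes-instance of `UMA (k+2)` for the code `e` of Arthur's machine (`mem_UMARef_iff`,
  `uniformProb_UMARef_eq`), since the universal machine answers Arthur's verdict within the budget
  and coins beyond the scale are irrelevant (`uniformProb_take_of_le`);
* **`preimage_wOf_mem_NTIME_two_pow`** — for `L⋆ ∈ NP` there is `q₀` such that for every
  `q ≥ q₀` and every `e`, `{x | wOf q e x ∈ L⋆} ∈ NTIME(2ⁿ)`: the verifier is the truncating wrapper
  (`truncMapAux`, `TruncMapMachine.lean`) of the clock "`FP` preprocessing, then `expPad 1` under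
  `mapFstAux` (`MapFstMachine.lean`), then the witness ruler `1^{p⋆(|w|)}`", followed by the
  `P`-decider of the verifier relation of `L⋆`; its time is a polynomial of degree `≤ q₀` in
  `2^{n/q}` plus `|y|/2`, i.e. `O(2ⁿ)`;
* **`exists_NTIME_two_pow_of_ioma`** — `pr-MA ⊆ pr-NP →  IOMA A → ∃ B ∈ NTIME(2ⁿ), ∃ᶠ n, ∀ x,
  |x| = n → (x ∈ A ↔ x ∈ B)`.

Everything is proved; the definitions are the interface predicate `IOMA`, the universal problem
and the verifier bricks. No named fact is introduced (D-0026). The consumers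
(`MetaComplexity/AvgCaseDerandomizationLemma34.lean`) are Buhrman–Fortnow–Pavan's Thm. 3.1
(`BuhrmanFortnowPavan2004_PromiseBPP'_subset_PromiseP_of_lemma37`) and Hirahara 2021's Lemma 3.4
(`Hirahara2021_hardE_of_lemma37`), both thereby reduced to BFP's Lemma 3.4 (probabilistically
checkable proofs for `E` turned into Merlin–Arthur protocols by the small circuits).

## References

* H. Buhrman, L. Fortnow, A. Pavan, *Some results on derandomization*, Theory Comput. Syst. 38
  (2005) 211–227, Lemma 3.4, Lemma 3.7 and its proof (p. 5–6) [BuhrmanFortnowPavan2004].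
* J. Köbler, R. Schuler, *Average-case intractability vs. worst-case intractability*, Inform. and
  Comput. 190 (2004) 1–17 (`MA = NP` under the average-case hypothesis; BFP Thm. 3.6) [KS04].
* S. Hirahara, ECCC TR21-058 (2021), Lemma 3.4, proof sketch, items 2–3 (p. 20) [Hirahara2021].
* R. Impagliazzo, V. Kabanets, A. Wigderson, JCSS 65 (2002), §2.1 (`MA` by a predicate) [ImpagliazzoKabanetsWigderson2002].
* S. Arora, B. Barak, *Computational Complexity: A Modern Approach*, CUP 2009, §2.6.2 (padding),
  Thm. 1.9 with §1.4.1 (clocked universal machine), §1.3 [AroraBarakCC2009].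
-/

noncomputable section

namespace Literature.Computability.Complexity

open _root_.Computability Polynomial Filter Brick Turing Plumb

namespace IoMA

/-! ### The interface: infinitely-often `MA` protocols at time scale `2^{O(n/q)}` -/

/-- **The scale** of the protocol with parameter `q` at length `n`: `maScale q n = 2^{⌊n/q⌋ + 1}`
(messages and coins have this length; Arthur's time is polynomial in it). [cite: BuhrmanFortnowPavan2004, Lemma 3.4] -/
def maScale (q n : ℕ) : ℕ := 2 ^ (n / q + 1)

/-- **`IOMA A`: the conclusion of Buhrman–Fortnow–Pavan's Lemma 3.4 for the language `A`.** There
is ONE exponent `k` such that for every scale parameter `q ≥ 1` some referee `R ∈ DTIME(N^k)`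
(read on triples `⟨⟨x, y⟩, z⟩`; so Arthur uses time `2^{O(k n/q)}` — "time `2^{εn}`" for every
`ε > 0`) is correct at all inputs of infinitely many lengths `n`, with Merlin's message `y` and
Arthur's coins `z` of length `maScale q n`: on `x ∈ A` some message is accepted with probability
`≥ 2/3`, on `x ∉ A` every message is accepted with probability `≤ 1/3`.
[cite: BuhrmanFortnowPavan2004, Lemma 3.4] [cite: ImpagliazzoKabanetsWigderson2002, §2.1] -/
def IOMA (A : Language Bool) : Prop :=
  ∃ k : ℕ, ∀ q : ℕ, 0 < q → ∃ R ∈ DTIME (fun N => N ^ k), ∃ᶠ n in atTop, ∀ x : List Bool, x.length = n →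
    (x ∈ A → ∃ y : List Bool, y.length = maScale q n ∧
      2 / 3 ≤ uniformProb (maScale q n) {z | boolPair (boolPair x y) z ∈ R}) ∧
    (x ∉ A → ∀ y : List Bool, y.length = maScale q n →
      uniformProb (maScale q n) {z | boolPair (boolPair x y) z ∈ R} ≤ 1 / 3)

/-! ### The universal promise-`MA` problem -/

/-- The scale read off the first component `v` of an instance: `min (2^{⌊log₂(|v|-1)⌋}) |v|`
(`= 2^m` when `|v| = 2^m + m + 1`, the length of the pad `expPad 1` of an `m`-bit word). [folklore] -/
def scaleOf (v : List Bool) : ℕ := min (2 ^ Nat.log 2 (v.length - 1)) v.length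

/-- The scale in unary: `v ↦ 1^{scaleOf v}` (the numeral `0^{ℓ}1 = bin 2^ℓ`, `ℓ = ⌊log₂(|v|-1)⌋`,
converted on the ruler `v`). [folklore] -/
def scaleU : List Bool → List Bool :=
  binToUnaryFn ∘ fanoutFn id (fun v => Kannan.zerosFn (logFn v.tail) ++ [true])

/-- The components of a triple `t = ⟨⟨w, y⟩, z⟩`: `w`. [folklore] -/
def wT : List Bool → List Bool := fstP ∘ fstP
/-- `y`. [folklore] -/
def yT : List Bool → List Bool := sndP ∘ fstP
/-- `v = fst w` (the name-twin `ADH.vT_mem_FP` of `QuantumComplexity/ADHMachine.lean` concerns a different map). [folklore] -/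
def vT : List Bool → List Bool := fstP ∘ wT
/-- `e = fst (snd w)`. [folklore] -/
def eT : List Bool → List Bool := fstP ∘ sndP ∘ wT
/-- `x = snd (snd w)`. [folklore] -/
def xT : List Bool → List Bool := sndP ∘ sndP ∘ wT
/-- `M = scaleOf v` in unary. [folklore] -/
def MT : List Bool → List Bool := scaleU ∘ vT
/-- `y ↾ M` (the name-twin `OrbitDecider.Majority.yM_mem_FP` of `CountingHierarchyPSPACE.lean` concerns a different map). [folklore] -/
def yM : List Bool → List Bool := takeFn ∘ fanoutFn MT yT
/-- `z ↾ M`. [folklore] -/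
def zM : List Bool → List Bool := takeFn ∘ fanoutFn MT sndP
/-- The budget `1^{|w|^{k'}}`. [folklore] -/
def clockT (k' : ℕ) : List Bool → List Bool := polyFn (X ^ k') ∘ wT

/-- **The referee map**: `⟨⟨w, y⟩, z⟩ ↦ ⟨e, ⟨⟨⟨x, y ↾ M⟩, z ↾ M⟩, 1^{|w|^{k'}}⟩⟩`, an instance of the
clocked universal acceptance language. [cite: AroraBarakCC2009, Thm. 1.9 and §1.4.1] -/
def refMap (k' : ℕ) : List Bool → List Bool :=
  fanoutFn eT (fanoutFn (fanoutFn (fanoutFn xT yM) zM) (clockT k'))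

/-- **The universal referee** with clock exponent `k'`: accept `⟨⟨w, y⟩, z⟩`, `w = ⟨v, ⟨e, x⟩⟩`, iff
the program `e` accepts `⟨⟨x, y ↾ M⟩, z ↾ M⟩` within the budget `|w|^{k'}` of the clocked universal
machine. [cite: AroraBarakCC2009, Thm. 1.9 and §1.4.1] -/
def UMARef (k' : ℕ) : Language Bool :=
  {t | ((fun w => encodeBool (ClockedUA.U.boolIndicator w)) ∘ refMap k') t = (fun _ => [true]) t}

/-- Membership in the universal referee language: the referee map lands in `ClockedUA.U`. [folklore] -/
theorem mem_UMARef_iff_U (k' : ℕ) (t : List Bool) : t ∈ UMARef k' ↔ refMap k' t ∈ ClockedUA.U := by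
  change [ClockedUA.U.boolIndicator (refMap k' t)] = [true] ↔ _
  rw [List.singleton_inj]
  exact boolIndicator_eq_true_iff' _ _

/-- **The universal promise-`MA` problem** with clock exponent `k'`: yes-instances have a message of
the same length accepted by `UMARef k'` with probability `≥ 2/3` over coins of the same length,
no-instances have every such message accepted with probability `≤ 1/3`.
[cite: ImpagliazzoKabanetsWigderson2002, §2.1] -/
def UMA (k' : ℕ) : PromiseProblem where
  yes := {w | ∃ y : List Bool, y.length = w.length ∧
    2 / 3 ≤ uniformProb w.length {z | boolPair (boolPair w y) z ∈ UMARef k'}}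
  no := {w | ∀ y : List Bool, y.length = w.length →
    uniformProb w.length {z | boolPair (boolPair w y) z ∈ UMARef k'} ≤ 1 / 3}

/-! #### Polynomial time -/

/-- `scaleU ∈ FP`. [folklore] -/
theorem scaleU_mem_FP : scaleU ∈ FP :=
  comp_mem_FP binToUnaryFn_mem_FP (fanoutFn_mem_FP (PolyTimeComputable.id _)
    (append_mem_FP (comp_mem_FP Kannan.zerosFn_mem_FP (comp_mem_FP logFn_mem_FP PRelSigma.tail_mem_FP))
      (const_mem_FP _)))

/-- `wT ∈ FP`. [folklore] -/
theorem wT_mem_FP : wT ∈ FP := comp_mem_FP fstP_mem_FP fstP_mem_FP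
/-- `yT ∈ FP`. [folklore] -/
theorem yT_mem_FP : yT ∈ FP := comp_mem_FP sndP_mem_FP fstP_mem_FP
/-- `vT ∈ FP`. [folklore] -/
theorem vT_mem_FP : vT ∈ FP := comp_mem_FP fstP_mem_FP wT_mem_FP
/-- `eT ∈ FP`. [folklore] -/
theorem eT_mem_FP : eT ∈ FP := comp_mem_FP fstP_mem_FP (comp_mem_FP sndP_mem_FP wT_mem_FP)
/-- `xT ∈ FP`. [folklore] -/
theorem xT_mem_FP : xT ∈ FP := comp_mem_FP sndP_mem_FP (comp_mem_FP sndP_mem_FP wT_mem_FP)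
/-- `MT ∈ FP`. [folklore] -/
theorem MT_mem_FP : MT ∈ FP := comp_mem_FP scaleU_mem_FP vT_mem_FP
/-- `yM ∈ FP`. [folklore] -/
theorem yM_mem_FP : yM ∈ FP := comp_mem_FP takeFn_mem_FP (fanoutFn_mem_FP MT_mem_FP yT_mem_FP)
/-- `zM ∈ FP`. [folklore] -/
theorem zM_mem_FP : zM ∈ FP := comp_mem_FP takeFn_mem_FP (fanoutFn_mem_FP MT_mem_FP sndP_mem_FP)
/-- `clockT k' ∈ FP`. [folklore] -/
theorem clockT_mem_FP (k' : ℕ) : clockT k' ∈ FP := comp_mem_FP (polyFn_mem_FP _) wT_mem_FP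

/-- `refMap k' ∈ FP`. [folklore] -/
theorem refMap_mem_FP (k' : ℕ) : refMap k' ∈ FP :=
  fanoutFn_mem_FP eT_mem_FP (fanoutFn_mem_FP (fanoutFn_mem_FP (fanoutFn_mem_FP xT_mem_FP yM_mem_FP) zM_mem_FP)
    (clockT_mem_FP k'))

/-- **The universal referee is polynomial time** (`ClockedUA.U ∈ P` behind an `FP` map).
[cite: AroraBarakCC2009, Thm. 1.9 and §1.4.1] -/
theorem UMARef_mem_P (k' : ℕ) : UMARef k' ∈ Classes.P :=
  setOf_apply_eq_apply_mem_P (comp_mem_FP (indicatorFn_mem_FP ClockedUA.U_mem_P) (refMap_mem_FP k'))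
    (const_mem_FP [true])

/-- **The universal problem is in promise-`MA`** (referee `UMARef k'`, message length `|w|`): its
promise is the definition of the class. [cite: ImpagliazzoKabanetsWigderson2002, §2.1] -/
theorem UMA_mem_PromiseMA' (k' : ℕ) : UMA k' ∈ PromiseMA' := by
  refine ⟨UMARef k', UMARef_mem_P k', X, fun w hw => ?_, fun w hw => ?_⟩
  · obtain ⟨y, hy, h⟩ := hw
    exact ⟨y, by rw [eval_X]; exact hy, by rw [eval_X]; exact h⟩
  · intro y hy
    rw [eval_X] at hy ⊢
    exact hw y hy

/-! #### Values -/

/-- Value of `scaleU`: `1^{scaleOf v}`. [folklore] -/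
theorem scaleU_apply (v : List Bool) : scaleU v = ones (scaleOf v) := by
  unfold scaleU scaleOf
  rw [Function.comp_apply, fanoutFn_apply, binToUnaryFn_boolPair]
  simp only [id, Kannan.zerosFn_apply, logFn, List.length_replicate, List.length_tail]
  rw [show List.replicate (Nat.log 2 (v.length - 1)) false ++ [true] = encodeNat (2 ^ Nat.log 2 (v.length - 1)) by
    rw [Com.encodeNat_two_pow], bitsToNat_encodeNat]

/-- Value of the referee map on a triple `⟨⟨w, y⟩, z⟩` with `w = ⟨v, ⟨e, x⟩⟩`. [folklore] -/
theorem refMap_apply (k' : ℕ) (v e x y z : List Bool) :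
    refMap k' (boolPair (boolPair (boolPair v (boolPair e x)) y) z) =
      boolPair e (boolPair (boolPair (boolPair x (y.take (scaleOf v))) (z.take (scaleOf v)))
        (ones ((boolPair v (boolPair e x)).length ^ k'))) := by
  simp [refMap, eT, xT, yM, zM, MT, vT, wT, yT, clockT, fanoutFn_apply, Function.comp_apply, scaleU_apply, ones]

/-! ### The padding and the semantics of the universal referee -/

/-- The pad exponent `m = ⌊n/q⌋ + 1` of an input of length `n` (`2^m = maScale q n`). [folklore] -/
def mOf (q : ℕ) (x : List Bool) : ℕ := x.length / q + 1

/-- `2^{mOf q x} = maScale q |x|`. [folklore] -/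
theorem two_pow_mOf (q : ℕ) (x : List Bool) : 2 ^ mOf q x = maScale q x.length := rfl

/-- `mOf q x ≤ |x|` once `q ≥ 2`, `|x| ≥ 2`. [folklore] -/
theorem mOf_le_length {q : ℕ} (hq : 2 ≤ q) {x : List Bool} (hx : 2 ≤ x.length) : mOf q x ≤ x.length := by
  unfold mOf
  have : x.length / q ≤ x.length / 2 := Nat.div_le_div_left hq two_pos
  omega

/-- `mOf q x + 1 ≤ maScale q |x|`. [folklore] -/
theorem mOf_lt_maScale (q : ℕ) (x : List Bool) : mOf q x + 1 ≤ maScale q x.length := by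
  rw [← two_pow_mOf]
  exact Nat.lt_two_pow_self

/-- **The padded instance** of `x` at scale parameter `q` for the program `e`:
`wOf q e x = ⟨expPad 1 (x ↾ (⌊n/q⌋ + 1)), ⟨e, x⟩⟩`. [cite: AroraBarakCC2009, §2.6.2] -/
def wOf (q : ℕ) (e x : List Bool) : List Bool :=
  boolPair (expPad 1 (x.take (mOf q x))) (boolPair e x)

/-- `⌊log₂ (2^m + m)⌋ = m`. [folklore] -/
theorem log_two_pow_add_self (m : ℕ) : Nat.log 2 (2 ^ m + m) = m := by
  refine Nat.log_eq_of_pow_le_of_lt_pow (Nat.le_add_right _ _) ?_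
  rw [pow_succ]
  have := Nat.lt_two_pow_self (n := m)
  omega

/-- The scale coded by an exponential pad: `scaleOf (expPad 1 u) = 2^{|u|}`. [folklore] -/
theorem scaleOf_expPad (u : List Bool) : scaleOf (expPad 1 u) = 2 ^ u.length := by
  unfold scaleOf
  simp only [length_expPad, pow_one, Nat.add_sub_cancel]
  rw [log_two_pow_add_self]
  exact min_eq_left (by omega)

/-- For `2 ≤ q` and `2 ≤ n = |x|` the prefix `x ↾ mOf q x` has length `mOf q x`. [folklore] -/
theorem length_take_mOf {q : ℕ} (hq : 2 ≤ q) {x : List Bool} (hx : 2 ≤ x.length) :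
    (x.take (mOf q x)).length = mOf q x := by
  rw [List.length_take, min_eq_left (mOf_le_length hq hx)]

/-- The scale of the padded instance is `maScale q n` (`q ≥ 2`, `n ≥ 2`). [folklore] -/
theorem scaleOf_wOf {q : ℕ} (hq : 2 ≤ q) {x : List Bool} (hx : 2 ≤ x.length) :
    scaleOf (expPad 1 (x.take (mOf q x))) = maScale q x.length := by
  rw [scaleOf_expPad, length_take_mOf hq hx, two_pow_mOf]

/-- Length of the padded instance. [folklore] -/
theorem length_wOf {q : ℕ} (hq : 2 ≤ q) (e : List Bool) {x : List Bool} (hx : 2 ≤ x.length) :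
    (wOf q e x).length = 2 * (maScale q x.length + mOf q x + 1) + 2 + (2 * e.length + 2 + x.length) := by
  unfold wOf
  rw [length_boolPair, length_boolPair, length_expPad, pow_one, length_take_mOf hq hx, two_pow_mOf]

/-- The scale is at most the length of the padded instance. [folklore] -/
theorem maScale_le_length_wOf {q : ℕ} (hq : 2 ≤ q) (e : List Bool) {x : List Bool} (hx : 2 ≤ x.length) :
    maScale q x.length ≤ (wOf q e x).length := by
  rw [length_wOf hq e hx]; omega

/-- The padded instance is longer than the payload. [folklore] -/
theorem length_le_length_wOf (q : ℕ) (e x : List Bool) : x.length ≤ (wOf q e x).length := by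
  unfold wOf; rw [length_boolPair, length_boolPair]; omega

/-- A crude upper bound: `|wOf q e x| ≤ 4 · maScale q n + n + (2|e| + 8)` (`q ≥ 2`, `n ≥ 2`). [folklore] -/
theorem length_wOf_le {q : ℕ} (hq : 2 ≤ q) (e : List Bool) {x : List Bool} (hx : 2 ≤ x.length) :
    (wOf q e x).length ≤ 4 * maScale q x.length + x.length + (2 * e.length + 8) := by
  rw [length_wOf hq e hx]
  have h1 := mOf_lt_maScale q x
  omega

/-- The same bound without side conditions: `|wOf q e x| + 1 ≤ 4 · maScale q n + n + (2|e| + 8)`. [folklore] -/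
theorem length_wOf_succ_le (q : ℕ) (e x : List Bool) :
    (wOf q e x).length + 1 ≤ 4 * maScale q x.length + x.length + (2 * e.length + 8) := by
  unfold wOf
  rw [length_boolPair, length_boolPair, length_expPad, pow_one]
  have hu : (x.take (mOf q x)).length ≤ mOf q x := List.length_take_le _ _
  have h2 : 2 ^ (x.take (mOf q x)).length ≤ maScale q x.length := by
    rw [← two_pow_mOf]; exact Nat.pow_le_pow_right two_pos hu
  have h1 := mOf_lt_maScale q x
  omega

/-- The pad is at most twice the scale: `|expPad 1 (x ↾ m)| ≤ 2 · maScale q n`. [folklore] -/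
theorem length_expPad_take_le (q : ℕ) (x : List Bool) :
    (expPad 1 (x.take (mOf q x))).length ≤ 2 * maScale q x.length := by
  rw [length_expPad, pow_one]
  have hu : (x.take (mOf q x)).length ≤ mOf q x := List.length_take_le _ _
  have h2 : 2 ^ (x.take (mOf q x)).length ≤ maScale q x.length := by
    rw [← two_pow_mOf]; exact Nat.pow_le_pow_right two_pos hu
  have h1 := mOf_lt_maScale q x
  omega

section Semantics

variable {k : ℕ} {R : Language Bool} (MR : TM2ComputableAux Bool Bool) {c : ℕ}

/-- Outputs of a machine are unique. [folklore] -/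
theorem outputsWithin_unique' {l l₁ l₂ : List Bool} {m₁ m₂ : ℕ} (h₁ : MR.OutputsWithin l l₁ m₁)
    (h₂ : MR.OutputsWithin l l₂ m₂) : l₁ = l₂ :=
  List.map_injective_iff.2 MR.outputAlphabet.symm.injective (TM2Std.outputs_unique MR.tm h₁ h₂)

/-- **The universal referee answers Arthur's verdict.** If `MR` decides `R` within `c N^k + c`
steps, `e = code MR`, and the instance `w = ⟨v, ⟨e, x⟩⟩` is long enough
(`haltAddr · c · 8^k + haltAddr · c + 8 ≤ |w|`, `|x| ≤ |w|`, `scaleOf v ≤ |w|`), then for all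
`y, z`: `⟨⟨w, y⟩, z⟩ ∈ UMARef (k+2) ↔ ⟨⟨x, y ↾ M⟩, z ↾ M⟩ ∈ R`, `M = scaleOf v`.
[cite: AroraBarakCC2009, Thm. 1.9 and §1.4.1] -/
theorem mem_UMARef_iff
    (hMR : ∀ t : List Bool, MR.OutputsWithin t (encodeBool (R.boolIndicator t)) (c * t.length ^ k + c))
    {e : List Bool} (he : e = ClockedUA.code MR) {v x w : List Bool} (hw : w = boolPair v (boolPair e x))
    (hx : x.length ≤ w.length) (hM : scaleOf v ≤ w.length)
    (hbig : FlatProg.haltAddr (ClockedUA.cM MR) * c * 8 ^ k + FlatProg.haltAddr (ClockedUA.cM MR) * c + 8 ≤ w.length)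
    (y z : List Bool) :
    boolPair (boolPair w y) z ∈ UMARef (k + 2) ↔
      boolPair (boolPair x (y.take (scaleOf v))) (z.take (scaleOf v)) ∈ R := by
  have hinst : refMap (k + 2) (boolPair (boolPair w y) z) =
      ClockedUA.inst MR (boolPair (boolPair x (y.take (scaleOf v))) (z.take (scaleOf v)))
        (List.replicate (w.length ^ (k + 2)) true) := by
    rw [hw, refMap_apply, he]
    simp only [ClockedUA.inst, ones]
  rw [mem_UMARef_iff_U, hinst]
  generalize ht : boolPair (boolPair x (y.take (scaleOf v))) (z.take (scaleOf v)) = t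
  have htlen : t.length ≤ 8 * w.length := by
    rw [← ht, length_boolPair, length_boolPair]
    have hy : (y.take (scaleOf v)).length ≤ scaleOf v := List.length_take_le _ _
    have hz : (z.take (scaleOf v)).length ≤ scaleOf v := List.length_take_le _ _
    omega
  generalize hL : w.length = L at htlen hbig hx
  have hrun := hMR t
  -- the budget suffices
  have hbudget : (ClockedUA.pM MR).eval (c * t.length ^ k + c) ≤ L ^ (k + 2) := by
    have e1 : (ClockedUA.pM MR).eval (c * t.length ^ k + c) =
        FlatProg.haltAddr (ClockedUA.cM MR) * (c * t.length ^ k + c) := by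
      simp [ClockedUA.pM]
    rw [e1]
    generalize FlatProg.haltAddr (ClockedUA.cM MR) = h at hbig ⊢
    have h2 : t.length ^ k ≤ 8 ^ k * L ^ k := by
      rw [← mul_pow]; exact Nat.pow_le_pow_left htlen k
    have hL1 : 1 ≤ L := by omega
    have h1w : 1 ≤ L ^ k := Nat.one_le_pow _ _ hL1
    have h3 : h * (c * t.length ^ k + c) ≤ (h * c * 8 ^ k + h * c) * L ^ k :=
      calc h * (c * t.length ^ k + c) = h * c * t.length ^ k + h * c * 1 := by ring
        _ ≤ h * c * (8 ^ k * L ^ k) + h * c * L ^ k :=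
          Nat.add_le_add (Nat.mul_le_mul_left _ h2) (Nat.mul_le_mul_left _ h1w)
        _ = (h * c * 8 ^ k + h * c) * L ^ k := by ring
    refine h3.trans ?_
    rw [pow_add, mul_comm]
    refine Nat.mul_le_mul_left _ ?_
    exact le_trans (by omega) (Nat.le_self_pow two_ne_zero L)
  constructor
  · intro hin
    obtain ⟨t₀, ht₀⟩ := ClockedUA.sound MR hin
    have heq := outputsWithin_unique' MR ht₀ hrun
    have hb : R.boolIndicator t = true := by
      have := congrArg List.head? heq
      simpa [encodeBool] using this.symm
    exact (boolIndicator_eq_true_iff' R t).1 hb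
  · intro hin
    have hb : R.boolIndicator t = true := (boolIndicator_eq_true_iff' R t).2 hin
    rw [hb] at hrun
    exact ClockedUA.complete MR hrun hbudget

end Semantics


/-! ### Arithmetic of the scale -/

/-- **Powers of the scale are `O(2ⁿ)`**: for `d ≤ q`, `0 < q`,
`(4 · 2^{⌊n/q⌋+1} + n + K)^d ≤ ((5 + q + K) · 2)^d · 2ⁿ`. [folklore] -/
theorem pow_scale_le (K d q : ℕ) (hd : d ≤ q) (hq : 0 < q) (n : ℕ) :
    (4 * maScale q n + n + K) ^ d ≤ ((5 + q + K) * 2) ^ d * 2 ^ n := by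
  have hpos : 0 < maScale q n := by unfold maScale; positivity
  have hm : n / q + 1 ≤ maScale q n := (Nat.lt_two_pow_self).le
  have hn : n ≤ q * maScale q n := by
    have h1 : n < q * (n / q + 1) := Nat.lt_mul_div_succ n hq
    have h2 : q * (n / q + 1) ≤ q * maScale q n := Nat.mul_le_mul_left q hm
    omega
  have hK : K ≤ K * maScale q n := Nat.le_mul_of_pos_right K hpos
  have hbase : 4 * maScale q n + n + K ≤ (5 + q + K) * maScale q n := by nlinarith
  have hdn : d * (n / q) ≤ n := (Nat.mul_le_mul_right _ hd).trans (Nat.mul_div_le n q)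
  calc (4 * maScale q n + n + K) ^ d ≤ ((5 + q + K) * maScale q n) ^ d := Nat.pow_le_pow_left hbase d
    _ = (5 + q + K) ^ d * (2 ^ d * 2 ^ (d * (n / q))) := by
        rw [mul_pow, maScale, ← pow_mul, ← pow_add]
        congr 2
        ring
    _ ≤ (5 + q + K) ^ d * (2 ^ d * 2 ^ n) :=
        Nat.mul_le_mul_left _ (Nat.mul_le_mul_left _ (Nat.pow_le_pow_right two_pos hdn))
    _ = ((5 + q + K) * 2) ^ d * 2 ^ n := by rw [mul_pow]; ring

/-- Monotonicity of powers in both arguments (base `≥ 1`). [folklore] -/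
theorem pow_le_pow_of_le_of_le {m S d D : ℕ} (hm : m ≤ S) (hS : 1 ≤ S) (hd : d ≤ D) : m ^ d ≤ S ^ D :=
  (Nat.pow_le_pow_left hm d).trans (Nat.pow_le_pow_right hS hd)

/-- The constant of the verifier's time bound. [folklore] -/
def arithConst (c₃ C cP a kV : ℕ) : ℕ :=
  c₃ + c₃ + (C + C) + 6 + 2 + 6 + 3 + (cP + cP + cP + cP) + 2 + 11 + (a * (2 + 2 * cP) ^ kV + a) + (cP + cP)

/-- **The arithmetic of the verifier's running time** (all quantities as plain naturals): with the
scale quantity `S = 4M + n + K` dominating the instance length `W`, the preprocessed length `pre`,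
and with the polynomial bounds of the witness ruler (`PW`), the ruler machine (`p3W`) and the
decider's input length (`T`), the total cost except the witness-reading is `≤ const · S^q` as soon as
`q` dominates the degrees. [folklore] -/
theorem verifier_arith {q d₃ dP kV c₃ cP C a M n K W pre T PW p3W : ℕ}
    (hq : 0 < q) (hd₃ : d₃ ≤ q) (hdk : (dP + 1) * kV ≤ q) (hdP : dP ≤ q)
    (hW : W + 1 ≤ 4 * M + n + K) (hpre : pre ≤ 4 * M + n + K)
    (hPW : PW ≤ cP * W ^ dP + cP) (hp3 : p3W ≤ c₃ * W ^ d₃ + c₃) (hT : T ≤ 2 * W + 2 + PW) :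
    p3W + ((C * M + C) + 3 * (2 * M) + 2 * pre + 6) + 3 * W + 2 * PW + 2 * n + 11 + (a * T ^ kV + a) + PW ≤
      arithConst c₃ C cP a kV * (4 * M + n + K) ^ q := by
  obtain ⟨S, hS⟩ : ∃ S, S = 4 * M + n + K := ⟨_, rfl⟩
  rw [← hS] at hW hpre ⊢
  have hS1 : 1 ≤ S := by omega
  have hWS : W ≤ S := by omega
  have hMS : M ≤ S := by omega
  have hnS : n ≤ S := by omega
  obtain ⟨SD, hSD⟩ : ∃ SD, SD = S ^ q := ⟨_, rfl⟩
  rw [← hSD]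
  have hSSD : S ≤ SD := hSD ▸ Nat.le_self_pow hq.ne' S
  have h1SD : 1 ≤ SD := hS1.trans hSSD
  have t1 : p3W ≤ c₃ * SD + c₃ * SD := by
    have hp : W ^ d₃ ≤ SD := hSD ▸ pow_le_pow_of_le_of_le hWS hS1 hd₃
    nlinarith
  have t2 : PW ≤ cP * SD + cP * SD := by
    have hp : W ^ dP ≤ SD := hSD ▸ pow_le_pow_of_le_of_le hWS hS1 hdP
    nlinarith
  have t3 : a * T ^ kV + a ≤ (a * (2 + 2 * cP) ^ kV + a) * SD := by
    obtain ⟨T₀, hT₀⟩ : ∃ T₀, T₀ = S ^ (dP + 1) := ⟨_, rfl⟩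
    have hST : S ≤ T₀ := hT₀ ▸ Nat.le_self_pow (Nat.succ_ne_zero _) S
    have h1T : 1 ≤ T₀ := hS1.trans hST
    have hWdT : W ^ dP ≤ T₀ := hT₀ ▸ pow_le_pow_of_le_of_le hWS hS1 (Nat.le_succ _)
    have hlen : T ≤ (2 + 2 * cP) * T₀ := by nlinarith
    have hpw : T ^ kV ≤ (2 + 2 * cP) ^ kV * SD :=
      calc T ^ kV ≤ ((2 + 2 * cP) * T₀) ^ kV := Nat.pow_le_pow_left hlen kV
        _ = (2 + 2 * cP) ^ kV * S ^ ((dP + 1) * kV) := by rw [mul_pow, hT₀, ← pow_mul]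
        _ ≤ (2 + 2 * cP) ^ kV * SD := Nat.mul_le_mul_left _ (hSD ▸ Nat.pow_le_pow_right hS1 hdk)
    have h1 : a * T ^ kV ≤ a * ((2 + 2 * cP) ^ kV * SD) := Nat.mul_le_mul_left a hpw
    have h2 : a ≤ a * SD := Nat.le_mul_of_pos_right a h1SD
    nlinarith
  have hMSD : M ≤ SD := hMS.trans hSSD
  have t4 : C * M ≤ C * SD := Nat.mul_le_mul_left C hMSD
  have t4' : C ≤ C * SD := Nat.le_mul_of_pos_right C h1SD
  have hpreSD : pre ≤ SD := hpre.trans hSSD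
  have hnSD : n ≤ SD := hnS.trans hSSD
  have hWSD : W ≤ SD := hWS.trans hSSD
  have e1 : arithConst c₃ C cP a kV * SD =
      (c₃ * SD + c₃ * SD) + (C * SD + C * SD) + 6 * SD + 2 * SD + 6 * SD + 3 * SD +
        (cP * SD + cP * SD + cP * SD + cP * SD) + 2 * SD + 11 * SD + (a * (2 + 2 * cP) ^ kV + a) * SD +
        (cP * SD + cP * SD) := by
    unfold arithConst; ring
  rw [e1]
  generalize c₃ * SD = Y1 at t1 ⊢
  generalize cP * SD = Y2 at t2 ⊢
  generalize a * T ^ kV = Y3 at t3 ⊢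
  generalize (a * (2 + 2 * cP) ^ kV + a) * SD = Y4 at t3 ⊢
  generalize C * SD = Y5 at t4 t4' ⊢
  generalize C * M = Y6 at t4 ⊢
  omega

/-! ### The padded preimage of an `NP` language is in `NTIME(2ⁿ)` -/

section Verifier

open CodeFP PairFstTM

/-- The preprocessing map `x ↦ ⟨x ↾ m, ⟨e, x⟩⟩` (`m = ⌊n/q⌋ + 1`, cut at `|x|`). [folklore] -/
def preF (q : ℕ) (e : List Bool) (x : List Bool) : List Bool :=
  boolPair (x.take (min (mOf q x) x.length)) (boolPair e x)

/-- The cut is immaterial: `x ↾ min m |x| = x ↾ m` (twin of `RegevRoutine.take_min_length` in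
`Algebra/EuclideanLattices/RegevRoutineCoreFP.lean`, an unrelated file not imported here). [folklore] -/
theorem take_min_length (x : List Bool) (m : ℕ) : x.take (min m x.length) = x.take m := by
  rw [← List.take_take, List.take_length]

/-- Value of the preprocessing map. [folklore] -/
theorem preF_apply (q : ℕ) (e x : List Bool) : preF q e x = boolPair (x.take (mOf q x)) (boolPair e x) := by
  rw [preF, take_min_length]

/-- `preF q e ∈ FP` (typed `FP` algebra). [cite: AroraBarakCC2009, §1.3] -/
theorem preF_mem_FP (q : ℕ) (e : List Bool) : preF q e ∈ FP := by
  have hlen : CodeFP strE natE (fun x : List Bool => x.length) := (natOfUn.comp strLength).congr fun _ => rfl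
  have hm : CodeFP strE unE (fun x : List Bool => min (mOf q x) x.length) :=
    (unOfNatMin.comp (strLength.pair (natAdd.comp ((natDiv.comp (hlen.pair (const strE q))).pair (const strE 1))))).congr
      fun x => by simp [mOf]
  have htake : CodeFP strE strE (fun x : List Bool => x.take (min (mOf q x) x.length)) :=
    (strTake.comp (hm.pair (CodeFP.id strE))).congr fun _ => rfl
  have h : CodeFP strE (pairE strE (pairE strE strE)) (fun x : List Bool => (x.take (min (mOf q x) x.length), (e, x))) :=
    htake.pair ((const strE e).pair (CodeFP.id strE))
  exact (h.recodeOut (eγ := strE) (g' := preF q e) fun x => rfl).polyTimeComputable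

/-- Length of the preprocessed word: `|preF q e x| ≤ 4 · maScale q n + n + (2|e| + 8)`. [folklore] -/
theorem length_preF_le (q : ℕ) (e x : List Bool) :
    (preF q e x).length ≤ 4 * maScale q x.length + x.length + (2 * e.length + 8) := by
  rw [preF_apply, length_boolPair, length_boolPair]
  have hu : (x.take (mOf q x)).length ≤ mOf q x := List.length_take_le _ _
  have := mOf_lt_maScale q x
  omega

variable {Lstar : Language Bool}

/-- **The padded preimage of an `NP` language is in `NTIME(2ⁿ)`** for every large scale parameter:
for `L⋆ ∈ NP` there is `q₀` such that `{x | wOf q e x ∈ L⋆} ∈ NTIME(2ⁿ)` for all `q ≥ q₀` and all `e`.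
The verifier on `⟨x, y⟩`: the truncating wrapper of the clock
`x ↦ ⟨wOf q e x, 1^{p⋆(|wOf q e x|)}⟩` (preprocessing, `expPad 1` under `mapFstAux`, witness ruler)
cuts `y` to the admissible witnesses of `L⋆`, then the polynomial-time verifier relation of `L⋆` is
decided; all costs are polynomials of degree `≤ q₀` in `4 · 2^{⌊n/q⌋+1} + n + O(1)`, i.e. `O(2ⁿ)`,
plus `|y|/2`. [cite: AroraBarakCC2009, §2.6.2 (Thm. 2.22) and §1.3] -/
theorem preimage_wOf_mem_NTIME_two_pow (hL : Lstar ∈ Nondeterministic.NP) :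
    ∃ q₀ : ℕ, ∀ q : ℕ, q₀ ≤ q → ∀ e : List Bool, {x | wOf q e x ∈ Lstar} ∈ NTIME (fun n => 2 ^ n) := by
  obtain ⟨V, hV, P, hLV⟩ := hL
  -- the decider of the verifier relation
  simp only [Classes.P, Set.mem_iUnion] at hV
  obtain ⟨kV, a, MV, hMV⟩ := hV
  have hMV' : ∀ t : List Bool, MV.OutputsWithin t (encodeBool (V.boolIndicator t)) (a * t.length ^ kV + a) :=
    fun t => hMV t
  -- the witness ruler `w ↦ ⟨w, 1^{P |w|}⟩
  obtain ⟨p₃, M₃, hM₃⟩ : (fanoutFn id (polyFn P)) ∈ FP := fanoutFn_mem_FP (PolyTimeComputable.id _) (polyFn_mem_FP P)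
  -- the exponential pad
  obtain ⟨C, Mp, hMp⟩ := exists_timeComputable_expPad (k := 1) le_rfl
  -- degrees
  obtain ⟨c₃, d₃, hc₃⟩ := exists_eval_le_mul_pow_add p₃
  obtain ⟨cP, dP, hcP⟩ := exists_eval_le_mul_pow_add P
  refine ⟨d₃ + (dP + 1) * kV + dP + 2, fun q hq e => ?_⟩
  have hq0 : 0 < q := by omega
  have hD2 : (dP + 1) * kV ≤ q := by omega
  -- preprocessing
  obtain ⟨p₁, M₁, hM₁⟩ := preF_mem_FP q e
  obtain ⟨b₁, hb₁⟩ := TimeConstructible.exists_poly_le_two_pow_pow p₁ (le_refl 1)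
  -- the clock `x ↦ ⟨wOf q e x, 1^{P |wOf q e x|}⟩`
  let N : TM2ComputableAux Bool Bool := (M₁.comp (mapFstAux Mp)).comp M₃
  have hN : ∀ x : List Bool, N.OutputsWithin x (boolPair (wOf q e x) (ones (P.eval (wOf q e x).length)))
      (p₃.eval (wOf q e x).length + ((C * maScale q x.length + C) + 3 * (2 * maScale q x.length) +
        2 * (preF q e x).length + 6 + p₁.eval x.length)) := by
    intro x
    have h1 : M₁.OutputsWithin x (preF q e x) (p₁.eval x.length) := hM₁ x
    have h2 : (mapFstAux Mp).OutputsWithin (preF q e x) (wOf q e x)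
        ((C * maScale q x.length + C) + 3 * (2 * maScale q x.length) + 2 * (preF q e x).length + 6) := by
      have hfst : (boolUnpair (preF q e x)).1 = x.take (mOf q x) := by rw [preF_apply, boolUnpair_boolPair]
      have hrest : readRest (preF q e x) = boolPair e x := by rw [preF_apply, readRest_boolPair]
      have hp := hMp (x.take (mOf q x))
      simp only [id, pow_one] at hp
      have hu : (x.take (mOf q x)).length ≤ mOf q x := List.length_take_le _ _
      have h2u : 2 ^ (x.take (mOf q x)).length ≤ maScale q x.length := by
        rw [← two_pow_mOf]; exact Nat.pow_le_pow_right two_pos hu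
      have hp' : Mp.OutputsWithin (boolUnpair (preF q e x)).1 (expPad 1 (x.take (mOf q x))) (C * maScale q x.length + C) := by
        rw [hfst]
        exact hp.mono (by nlinarith)
      have h := outputsWithin_mapFstAux Mp hp'
      rw [hrest] at h
      have hle := length_expPad_take_le q x
      exact h.mono (by omega)
    have h3 : M₃.OutputsWithin (wOf q e x) (boolPair (wOf q e x) (ones (P.eval (wOf q e x).length))) (p₃.eval (wOf q e x).length) := by
      have := hM₃ (wOf q e x)
      simpa [fanoutFn_apply] using this
    have h12 := Turing.TM2ComputableAux.comp_outputsWithin _ _ h1 h2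
    exact Turing.TM2ComputableAux.comp_outputsWithin _ _ h12 h3
  -- the verifier and its constants
  let Vm : TM2ComputableAux Bool Bool := (truncMapAux N).comp MV
  obtain ⟨A₀, hA₀⟩ : ∃ A₀, A₀ = arithConst c₃ C cP a kV := ⟨_, rfl⟩
  obtain ⟨Kq, hKq⟩ : ∃ Kq : ℕ, Kq = (5 + q + (2 * e.length + 8)) * 2 := ⟨_, rfl⟩
  -- the `O(2ⁿ)` bound of everything but the witness-reading
  have hmain : ∀ (x y : List Bool),
      p₃.eval (wOf q e x).length + ((C * maScale q x.length + C) + 3 * (2 * maScale q x.length) + 2 * (preF q e x).length + 6 +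
        p₁.eval x.length) + 3 * (wOf q e x).length + 2 * (ones (P.eval (wOf q e x).length)).length + 2 * x.length + 11 +
        (a * (boolPair (wOf q e x) (y.take (P.eval (wOf q e x).length))).length ^ kV + a) + P.eval (wOf q e x).length ≤
        (A₀ * Kq ^ q + b₁) * 2 ^ x.length + b₁ := by
    intro x y
    have harith := verifier_arith (q := q) (C := C) (a := a) (M := maScale q x.length) (n := x.length) (K := 2 * e.length + 8)
      hq0 (by omega : d₃ ≤ q) hD2 (by omega : dP ≤ q) (length_wOf_succ_le q e x) (length_preF_le q e x)
      (hcP (wOf q e x).length) (hc₃ (wOf q e x).length)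
      (T := (boolPair (wOf q e x) (y.take (P.eval (wOf q e x).length))).length)
      (by rw [length_boolPair]; have := List.length_take_le (P.eval (wOf q e x).length) y; omega)
    have hSD := pow_scale_le (2 * e.length + 8) q q le_rfl hq0 x.length
    rw [← hKq] at hSD
    rw [← hA₀] at harith
    have t5 : p₁.eval x.length ≤ b₁ * 2 ^ x.length + b₁ := by simpa using hb₁ x.length
    have tones : (ones (P.eval (wOf q e x).length)).length = P.eval (wOf q e x).length := by simp [ones]
    rw [tones]
    have hA : A₀ * (4 * maScale q x.length + x.length + (2 * e.length + 8)) ^ q ≤ A₀ * Kq ^ q * 2 ^ x.length := by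
      rw [mul_assoc]; exact Nat.mul_le_mul_left _ hSD
    generalize p₃.eval (wOf q e x).length = X1 at harith ⊢
    generalize P.eval (wOf q e x).length = X2 at harith ⊢
    generalize (boolPair (wOf q e x) (List.take X2 y)).length = X3 at harith ⊢
    generalize (wOf q e x).length = X4 at harith ⊢
    generalize (preF q e x).length = X5 at harith ⊢
    generalize maScale q x.length = X6 at harith hA ⊢
    generalize p₁.eval x.length = X7 at t5 ⊢
    generalize A₀ * Kq ^ q = X8 at hA ⊢
    generalize 2 ^ x.length = X9 at hA t5 ⊢
    generalize (4 * X6 + x.length + (2 * e.length + 8)) ^ q = X10 at harith hA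
    generalize a * X3 ^ kV = X11 at harith ⊢
    nlinarith [harith, hA, t5]
  -- the presentation of `{x | wOf q e x ∈ L⋆}` in `NTIME(2ⁿ)`
  obtain ⟨X, hX⟩ : ∃ X : ℕ, X = A₀ * Kq ^ q + b₁ := ⟨_, rfl⟩
  rw [← hX] at hmain
  refine ⟨2 * X + 2 * b₁ + 2, fun x y => V.boolIndicator (boolPair (wOf q e x) (y.take (P.eval (wOf q e x).length))), Vm,
    fun x y hy => ?_, fun x => ?_⟩
  · -- running time
    have h₁ := outputsWithin_truncMapAux_boolPair N (y := y) (hN x)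
    have hlen : (ones (P.eval (wOf q e x).length)).length = P.eval (wOf q e x).length := by simp [ones]
    rw [hlen] at h₁
    have h₂ := hMV' (boolPair (wOf q e x) (y.take (P.eval (wOf q e x).length)))
    have h := Turing.TM2ComputableAux.comp_outputsWithin _ _ h₁ h₂
    refine h.mono ?_
    have hm := hmain x y
    rw [hlen] at hm
    have hy2 : 2 * (y.length / 2) ≤ (2 * X + 2 * b₁ + 2) * 2 ^ x.length + (2 * X + 2 * b₁ + 2) :=
      (Nat.mul_div_le y.length 2).trans hy
    have e1 : (2 * X + 2 * b₁ + 2) * 2 ^ x.length = 2 * (X * 2 ^ x.length) + 2 * (b₁ * 2 ^ x.length) + 2 * 2 ^ x.length := by ring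
    rw [e1] at hy2 ⊢
    generalize X * 2 ^ x.length = Z1 at hm hy2 ⊢
    generalize b₁ * 2 ^ x.length = Z2 at hy2 ⊢
    generalize 2 ^ x.length = Z3 at hy2 ⊢
    generalize p₃.eval (wOf q e x).length = X1 at hm ⊢
    generalize P.eval (wOf q e x).length = X2 at hm ⊢
    generalize a * (boolPair (wOf q e x) (List.take X2 y)).length ^ kV = X3 at hm ⊢
    generalize (wOf q e x).length = X4 at hm ⊢
    generalize (preF q e x).length = X5 at hm ⊢
    generalize C * maScale q x.length = X6 at hm ⊢
    generalize maScale q x.length = X7 at hm ⊢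
    generalize p₁.eval x.length = X8 at hm ⊢
    omega
  · -- correctness
    show wOf q e x ∈ Lstar ↔ _
    rw [hLV]
    constructor
    · rintro ⟨y₀, hy₀, hV₀⟩
      refine ⟨y₀, ?_, ?_⟩
      · have hm := hmain x y₀
        have e1 : (2 * X + 2 * b₁ + 2) * 2 ^ x.length = 2 * (X * 2 ^ x.length) + 2 * (b₁ * 2 ^ x.length) + 2 * 2 ^ x.length := by ring
        rw [e1]
        generalize X * 2 ^ x.length = Z1 at hm ⊢
        generalize b₁ * 2 ^ x.length = Z2 at ⊢
        generalize P.eval (wOf q e x).length = X2 at hm hy₀ ⊢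
        omega
      · show V.boolIndicator (boolPair (wOf q e x) (y₀.take (P.eval (wOf q e x).length))) = true
        rw [List.take_of_length_le hy₀]
        exact (boolIndicator_eq_true_iff' V _).2 hV₀
    · rintro ⟨y, -, hR⟩
      exact ⟨y.take _, List.length_take_le _ _, (boolIndicator_eq_true_iff' V _).1 hR⟩

end Verifier

/-! ### The simulation -/

/-- **Infinitely-often `MA` protocols at time scale `2^{O(n/q)}` are simulated in `NTIME(2ⁿ)` when
`pr-MA ⊆ pr-NP`** (the class-level step of Buhrman–Fortnow–Pavan's Lemma 3.7; Hirahara 2021,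
Lemma 3.4, proof sketch, items 2–3): if `A` has, with one exponent `k`, for every scale `q` a
`DTIME(N^k)` referee correct at infinitely many lengths (`IOMA A`), then some `B ∈ NTIME(2ⁿ)` agrees
with `A` on all inputs of infinitely many lengths. Proof: the universal promise-`MA` problem
`UMA (k+2)` is in `pr-MA`, hence (hypothesis) some `L⋆ ∈ NP` separates its promise; choose the scale
`q` beyond the threshold of `preimage_wOf_mem_NTIME_two_pow` for `L⋆`, take the referee `R` of scale
`q` with its machine `M_R`, and put `B = {x | wOf q (code M_R) x ∈ L⋆}`; at every good length that is
large enough for the universal machine's budget, `x ∈ A` makes the padded instance a yes-instance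
(pad Merlin's message; coins beyond the scale are irrelevant, `uniformProb_take_of_le`) and `x ∉ A`
makes it a no-instance. [cite: BuhrmanFortnowPavan2004, Lemma 3.7 (proof)]
[cite: Hirahara2021, Lemma 3.4 (proof sketch, items 2–3)] [cite: AroraBarakCC2009, §2.6.2] -/
theorem exists_NTIME_two_pow_of_ioma (hMA : PromiseMA' ⊆ PromiseNP) {A : Language Bool} (hA : IOMA A) :
    ∃ B ∈ NTIME (fun n => 2 ^ n), ∃ᶠ n in atTop, ∀ x : List Bool, x.length = n → (x ∈ A ↔ x ∈ B) := by
  obtain ⟨k, hk⟩ := hA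
  obtain ⟨Lstar, hLNP, hyes, hno⟩ := hMA (UMA_mem_PromiseMA' (k + 2))
  obtain ⟨q₀, hq₀⟩ := preimage_wOf_mem_NTIME_two_pow hLNP
  set q : ℕ := max q₀ 2 with hqdef
  have hq2 : 2 ≤ q := le_max_right _ _
  have hq₀q : q₀ ≤ q := le_max_left _ _
  obtain ⟨R, hR, hfreq⟩ := hk q (by omega)
  obtain ⟨c, MR, hMR⟩ := hR
  have hMR' : ∀ t : List Bool, MR.OutputsWithin t (encodeBool (R.boolIndicator t)) (c * t.length ^ k + c) := fun t => hMR t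
  set e : List Bool := ClockedUA.code MR with he
  refine ⟨{x | wOf q e x ∈ Lstar}, hq₀ q hq₀q e, ?_⟩
  refine (hfreq.and_eventually (eventually_ge_atTop
    (FlatProg.haltAddr (ClockedUA.cM MR) * c * 8 ^ k + FlatProg.haltAddr (ClockedUA.cM MR) * c + 8 + 2))).mono ?_
  rintro n ⟨hgood, hn⟩ x hx
  subst hx
  have hx2 : 2 ≤ x.length := by omega
  set w : List Bool := wOf q e x with hw
  set M : ℕ := maScale q x.length with hMdef
  have hwlen : x.length ≤ w.length := length_le_length_wOf q e x
  have hMw : M ≤ w.length := maScale_le_length_wOf hq2 e hx2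
  have hscale : scaleOf (expPad 1 (x.take (mOf q x))) = M := scaleOf_wOf hq2 hx2
  have href : ∀ y z : List Bool, boolPair (boolPair w y) z ∈ UMARef (k + 2) ↔
      boolPair (boolPair x (y.take M)) (z.take M) ∈ R := by
    intro y z
    have h := mem_UMARef_iff MR hMR' he (v := expPad 1 (x.take (mOf q x))) (x := x) (w := w) hw hwlen
      (by rw [hscale]; exact hMw) (by omega) y z
    rwa [hscale] at h
  have hprob : ∀ y : List Bool, uniformProb w.length {z | boolPair (boolPair w y) z ∈ UMARef (k + 2)} =
      uniformProb M {z | boolPair (boolPair x (y.take M)) z ∈ R} := by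
    intro y
    have hset : {z : List Bool | boolPair (boolPair w y) z ∈ UMARef (k + 2)} =
        {z | z.take M ∈ {z' : List Bool | boolPair (boolPair x (y.take M)) z' ∈ R}} := by
      ext z
      simp only [Set.mem_setOf_eq]
      exact href y z
    rw [hset, uniformProb_take_of_le hMw]
  obtain ⟨hyesA, hnoA⟩ := hgood x rfl
  constructor
  · intro hxA
    obtain ⟨y₀, hy₀, hpr⟩ := hyesA hxA
    have hwyes : w ∈ (UMA (k + 2)).yes := by
      refine ⟨y₀ ++ List.replicate (w.length - M) false, ?_, ?_⟩
      · rw [List.length_append, List.length_replicate, hy₀]; omega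
      · rw [hprob, List.take_append_of_le_length (by rw [hy₀]), ← hy₀, List.take_length]
        rw [hy₀]
        exact hpr
    exact hyes hwyes
  · intro hxB
    by_contra hxA
    have hwno : w ∈ (UMA (k + 2)).no := by
      intro y hy
      rw [hprob y]
      exact hnoA hxA (y.take M) (by rw [List.length_take, hy, min_eq_left hMw])
    exact hno hwno hxB

end IoMA

end Literature.Computability.Complexity

end
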